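/-
Copyright (c) 2026. All rights reserved.
Released under Apache 2.0 license as described in the file LICENSE.
-/
import Literature.AlgebraicGeometry.Pohlmann1968.CMTypeRankStabilizerBound
import HarnessLib

/-!
# Galois CM fields: `2·|Stab(Φ)|·(Rank(Φ) − 1) = [K:ℚ]` decides Hazama's dichotomy for all powers

SETTING (tree `CMTypeRankStabilizerBound`).  `K` a CM field which is GALOIS over `ℚ`, `Φ` a CM type of `K`,
`Stab(Φ) = {σ ∈ Gal(K/ℚ) : Φσ = Φ}` (tree `twistStabilizer`), `k_Φ = K^{Stab(Φ)}`, `Φ = Ψ^K` for a unique CM type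
`Ψ` of `k_Φ` (Lang's criterion, tree `exists_eq_inducedCMType_fixedField_twistStabilizer`), `Rank(Φ) = cmTypeRank Φ`.
The tree knows `2·|Stab(Φ)|·(Rank(Φ) − 1) ≤ [K:ℚ]` with equality iff `Ψ` is nondegenerate, and in that case the
Hodge conjecture for all powers of the abelian varieties of type `(K; Φ)`.  THIS FILE adds the converse through
Hazama's criterion (B. B. Gordon [Gordon1999HodgeAVSurvey] Thm. 6.4, tree
`isNondegenerate_iff_forall_pow_hodgeClassSpan_eq_inducedCMType`), whose hypothesis — `Ψ` PRIMITIVE on `k_Φ`, in the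
pattern form «`Aut(ℂ)`-patterns separate the embeddings of `k_Φ`» — is proved here for Galois `K`:

> **Theorem** (`pattern_primitive_of_inducedCMType_fixedField_twistStabilizer`).  For `K/ℚ` Galois the type `Ψ`
> of `k_Φ = K^{Stab(Φ)}` with `Ψ^K = Φ` is primitive: two embeddings `s, t : k_Φ → ℂ` with
> `τs ∈ Ψ ⟺ τt ∈ Ψ` for all `τ ∈ Aut(ℂ)` are equal (extend to `φ, φ' = φγ` on `K`; the pattern condition says
> `χγ ∈ Φ ⟺ χ ∈ Φ` for every `χ`, i.e. `γ ∈ Stab(Φ)`, so `γ` fixes `k_Φ`).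
> **Theorem** (`two_mul_natCard_twistStabilizer_mul_eq_iff_forall_pow_hodgeClassSpan_eq`).  For `K/ℚ` Galois, every
> CM type `Φ` and EVERY abelian variety `A` of type `(K; Φ)`:
> `2·|Stab(Φ)|·(Rank(Φ) − 1) = [K:ℚ] ⟺ Bᵐ(Aⁿ) ⊗ ℂ = Dᵐ(Aⁿ) ⊗ ℂ for all n, m`;
> and if `2·|Stab(Φ)|·(Rank(Φ) − 1) < [K:ℚ]` then SOME POWER `Aⁿ` CARRIES AN EXCEPTIONAL HODGE CLASS
> (`exists_exceptional_pow_of_two_mul_natCard_twistStabilizer_mul_lt`).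

So for Galois CM fields the pair `(Rank(Φ), |Stab(Φ)|)` — two integers computable from `Φ` — decides whether all
Hodge classes on all powers are generated by divisors (G. Shimura [Shimura1998] §8.2 Prop. 26: the simple factor
`B` of `A ≅ B^h` has CM by the reflex-type data of the primitive sub-pair; F. Hazama / Gordon Thm. 6.4:
`Hdg(Aⁿ) = Div(Aⁿ) ∀ n ⟺ dim Hg(B) = dim B`).

* §1 `comp_mem_iff_of_pattern` (the pattern condition on `K` moves to `Gal(K/ℚ)`),
  **`pattern_primitive_of_inducedCMType_fixedField_twistStabilizer`**.
* §2 **`two_mul_natCard_twistStabilizer_mul_eq_iff_forall_pow_hodgeClassSpan_eq`**,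
  **`exists_exceptional_pow_of_two_mul_natCard_twistStabilizer_mul_lt`**,
  `forall_pow_hodgeClassSpan_eq_or_exists_exceptional` (the dichotomy).

HONEST SCOPE.  Assembly: Hazama's criterion and the exceptional classes are the tree's
(`NonSimpleCMAbelianVarietyHazamaCriterion`); new here is only the primitivity of the stabiliser core for Galois `K`
and the restatement through `(Rank, |Stab|)`.  Non-Galois CM fields (where `Aut(K)` does not see all subfields) and
the location of the exceptional class on `A` itself (tree, abelian `k_Φ`) are not treated.  THEOREMS ONLY: no
definition, no named fact, no instance, no `sorry`.

## References

* [Gordon1999HodgeAVSurvey] B. B. Gordon, *A survey of the Hodge conjecture for abelian varieties*, Thm. 6.4, §9.3.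
* [Shimura1998] G. Shimura, *Abelian Varieties with Complex Multiplication and Modular Functions*, §8.2 Prop. 26,
  §8.4 Example (1), §32.9.
* [BCLLMNO2015] I. Bouw et al., *Bad reduction of genus three curves with complex multiplication*, §3 Prop. 3.3.
* [Lang1983ComplexMultiplication] S. Lang, *Complex Multiplication*, Ch. I Thm. 3.6.

## Provenance

Lane `lit-hodgefound` (Track 2, Layers A4/A5), seat `lit-hodgefound-p10` generation 39, row g39-#8; neighbours cited
by name, nothing restated: `CMTypeRankStabilizerBound` (g39-#7: `two_mul_natCard_twistStabilizer_mul_eq_iff`,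
`isNondegenerate_of_inducedCMType_fixedField_of_eq`, `eq_of_inducedCMType_isNondegenerate_fixedField`,
`two_mul_natCard_twistStabilizer_mul_cmTypeRank_sub_one_le`), `NonSimpleCMAbelianVarietyHazamaCriterion`
(`isNondegenerate_iff_forall_pow_hodgeClassSpan_eq_inducedCMType`, `exists_exceptional_pow_of_not_isNondegenerate_inducedCMType`),
`CMTypeRankCharactersNumberField` (`exists_algEquiv_comp_eq`), `NondegenerateCMTypeDivisorClasses`
(`isPretransitive_ringEquiv_complex`), `DegenerateCMTypeOverSubfield` (`restrict_surjective`),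
`CMTorusEquivalentCMTypes` (`mem_twist_iff`), `CMTypeEquivalenceClassesCount` (`twistStabilizer`,
`exists_eq_inducedCMType_fixedField_twistStabilizer`).
-/

open scoped BigOperators NumberField Classical
open NumberField Module CategoryTheory CategoryTheory.Limits IntermediateField

namespace Literature.AlgebraicGeometry.Pohlmann1968

open scoped Literature.NumberTheory.ComplexMultiplication
open Literature.NumberTheory.ComplexMultiplication (inducedCMType mem_inducedCMType_iff twistStabilizer
  mem_twistStabilizer_iff mem_twist_iff isCMField_of_cmType_intermediateField
  exists_eq_inducedCMType_fixedField_twistStabilizer)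
open Literature.AlgebraicGeometry.Motives (CMType AbelianVariety)
open Literature.AlgebraicGeometry.HodgeTheory
open Literature.AlgebraicGeometry.VanGeemen1994 (hodgeClassSpan)
open Literature.Barriers.HodgeConjecture (divisorClassesSpan)
open Literature.AlgebraicGeometry.ComplexMultiplication (IsCMTypeRealisation)

variable {K : Type} [Field K] [NumberField K] [IsCMField K]
  {A : AbelianVariety ℂ} {ι : 𝓞 K →+* End A} {θ : K →+* Module.End ℂ (complexBetti A.X 1)}

/-! ## §1 The stabiliser core of a CM type of a Galois CM field is primitive -/

section Core

omit [IsCMField K] in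
/-- **From `Aut(ℂ)`-patterns to the Galois group** (`K/ℚ` normal): if two embeddings `φ, φ' = φγ` of `K` satisfy
`τφ ∈ Φ ⟺ τφ' ∈ Φ` for all `τ ∈ Aut(ℂ)`, then `χγ ∈ Φ ⟺ χ ∈ Φ` for EVERY embedding `χ` (`Aut(ℂ)` is transitive
on `Hom(K, ℂ)`, tree `isPretransitive_ringEquiv_complex`). [cite: Shimura1998, §8.1 and §8.2 Prop. 26] -/
theorem comp_mem_iff_of_pattern {Φ : CMType K} {φ φ' : K →+* ℂ} {γ : K ≃ₐ[ℚ] K} (hγ : ∀ x, φ (γ x) = φ' x)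
    (hpat : ∀ τ : ℂ ≃+* ℂ, (τ : ℂ →+* ℂ).comp φ ∈ Φ.1 ↔ (τ : ℂ →+* ℂ).comp φ' ∈ Φ.1) (χ : K →+* ℂ) :
    χ.comp (γ : K →+* K) ∈ Φ.1 ↔ χ ∈ Φ.1 := by
  haveI := isPretransitive_ringEquiv_complex (K := K)
  obtain ⟨τ, rfl⟩ := MulAction.exists_smul_eq (ℂ ≃+* ℂ) φ χ
  have h1 : (τ • φ).comp (γ : K →+* K) = τ • φ' := by
    refine RingHom.ext fun x => ?_
    show τ (φ (γ x)) = τ (φ' x)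
    rw [hγ x]
  rw [h1]
  exact (hpat τ).symm

omit [IsCMField K] in
/-- **For `K/ℚ` GALOIS the type `Ψ` of `k_Φ = K^{Stab(Φ)}` inducing `Φ` is PRIMITIVE** (pattern form: embeddings of
`k_Φ` with the same `Aut(ℂ)`-pattern w.r.t. `Ψ` coincide): extend `s, t` to `φ, φ' = φγ` on `K`; by §1 `γ`
stabilises `Φ`, hence lies in `Stab(Φ) = Gal(K/k_Φ)` and fixes `k_Φ`, so `s = φ|_{k_Φ} = φ'|_{k_Φ} = t`
(Shimura §8.2 Prop. 26 `H₁ = H′` for the sub-pair `(k_Φ, Ψ)`). [cite: Shimura1998, §8.2 Prop. 26, §8.4 Example (1)]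
[cite: BCLLMNO2015, §3 Prop. 3.3] [cite: Lang1983ComplexMultiplication, Ch. I Thm. 3.6] -/
theorem pattern_primitive_of_inducedCMType_fixedField_twistStabilizer [IsGalois ℚ K] {Φ : CMType K}
    {Ψ : CMType (fixedField (twistStabilizer Φ))}
    (hΨ : inducedCMType (algebraMap (fixedField (twistStabilizer Φ)) K) Ψ = Φ)
    (s t : fixedField (twistStabilizer Φ) →+* ℂ)
    (hst : ∀ τ : ℂ ≃+* ℂ, (τ : ℂ →+* ℂ).comp s ∈ Ψ.1 ↔ (τ : ℂ →+* ℂ).comp t ∈ Ψ.1) : s = t := by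
  obtain ⟨φ, hφ⟩ := restrict_surjective (algebraMap (fixedField (twistStabilizer Φ)) K) s
  obtain ⟨φ', hφ'⟩ := restrict_surjective (algebraMap (fixedField (twistStabilizer Φ)) K) t
  dsimp only at hφ hφ'
  subst hφ hφ'
  -- membership in `Ψ` of a restriction is membership in `Φ = Ψ^K`
  have e1 : ∀ μ : K →+* ℂ, μ.comp (algebraMap (fixedField (twistStabilizer Φ)) K) ∈ Ψ.1 ↔ μ ∈ Φ.1 := fun μ => by
    rw [← mem_inducedCMType_iff (algebraMap (fixedField (twistStabilizer Φ)) K) Ψ μ, hΨ]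
  have hpat : ∀ τ : ℂ ≃+* ℂ, (τ : ℂ →+* ℂ).comp φ ∈ Φ.1 ↔ (τ : ℂ →+* ℂ).comp φ' ∈ Φ.1 := fun τ => by
    rw [← e1, ← e1, RingHom.comp_assoc, RingHom.comp_assoc]
    exact hst τ
  -- `φ' = φγ`, and `γ` stabilises `Φ`
  obtain ⟨γ, hγ⟩ := exists_algEquiv_comp_eq φ φ'
  have hstab : ∀ χ : K →+* ℂ, χ.comp (γ : K →+* K) ∈ Φ.1 ↔ χ ∈ Φ.1 := comp_mem_iff_of_pattern hγ hpat
  have hmem : γ ∈ twistStabilizer Φ := by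
    rw [mem_twistStabilizer_iff]
    apply Subtype.ext
    ext ψ
    have e : (ψ.comp (γ.symm : K →+* K)).comp (γ : K →+* K) = ψ := RingHom.ext fun x => by
      show ψ (γ.symm (γ x)) = ψ x
      rw [AlgEquiv.symm_apply_apply]
    rw [mem_twist_iff]
    exact (hstab (ψ.comp (γ.symm : K →+* K))).symm.trans (by rw [e])
  -- so `γ` fixes `k_Φ` pointwise and `s = t`
  refine RingHom.ext fun x => ?_
  have hfix : γ (x : K) = x := ((IntermediateField.mem_fixedField_iff (twistStabilizer Φ) (x : K)).1 x.2) γ hmem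
  show φ (x : K) = φ' (x : K)
  rw [← hγ (x : K), hfix]

end Core

/-! ## §2 The dichotomy: the extremal invariant decides Hazama's criterion -/

section Hazama

/-- **`K/ℚ` GALOIS: `2·|Stab(Φ)|·(Rank(Φ) − 1) = [K:ℚ] ⟺ Bᵐ(Aⁿ) ⊗ ℂ = Dᵐ(Aⁿ) ⊗ ℂ` FOR ALL `n, m`**, for every
abelian variety `A` of type `(K; Φ)` — Hazama's criterion (`Hdg(Aⁿ) = Div(Aⁿ) ∀ n ⟺` the primitive core is
nondegenerate) read through the stabiliser (the core is the type of `K^{Stab(Φ)}` inducing `Φ`, §1, and it is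
nondegenerate iff equality holds, tree `two_mul_natCard_twistStabilizer_mul_eq_iff`).
[cite: Gordon1999HodgeAVSurvey, Thm. 6.4] [cite: Shimura1998, §8.2 Prop. 26, §32.9] [cite: BCLLMNO2015, §3 Prop. 3.3] -/
theorem two_mul_natCard_twistStabilizer_mul_eq_iff_forall_pow_hodgeClassSpan_eq [IsGalois ℚ K] (Φ : CMType K)
    (hA : IsCMTypeRealisation Φ A ι θ) :
    2 * Nat.card (twistStabilizer Φ) * (cmTypeRank Φ - 1) = finrank ℚ K ↔
      ∀ n m : ℕ, hodgeClassSpan (⨁ fun _ : Fin n => A).dim (⨁ fun _ : Fin n => A).X m =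
        divisorClassesSpan (⨁ fun _ : Fin n => A).X (⨁ fun _ : Fin n => A).dim m := by
  obtain ⟨Ψ, hΨ⟩ := exists_eq_inducedCMType_fixedField_twistStabilizer Φ
  haveI : IsCMField (fixedField (twistStabilizer Φ)) :=
    isCMField_of_cmType_intermediateField (fixedField (twistStabilizer Φ)) Ψ
  rw [← isNondegenerate_iff_forall_pow_hodgeClassSpan_eq_inducedCMType hΨ
    (pattern_primitive_of_inducedCMType_fixedField_twistStabilizer hΨ) hA]
  exact ⟨isNondegenerate_of_inducedCMType_fixedField_of_eq hΨ, eq_of_inducedCMType_isNondegenerate_fixedField hΨ⟩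

/-- **`K/ℚ` GALOIS, `2·|Stab(Φ)|·(Rank(Φ) − 1) < [K:ℚ]` ⟹ SOME POWER OF `A` CARRIES AN EXCEPTIONAL HODGE CLASS**
(a rational `(m,m)`-class outside `Dᵐ ⊗ ℂ` on some `Aⁿ`), for every abelian variety `A` of type `(K; Φ)`.
[cite: Gordon1999HodgeAVSurvey, Thm. 6.4 and §9.2] [cite: Shimura1998, §8.2 Prop. 26] -/
theorem exists_exceptional_pow_of_two_mul_natCard_twistStabilizer_mul_lt [IsGalois ℚ K] (Φ : CMType K)
    (hlt : 2 * Nat.card (twistStabilizer Φ) * (cmTypeRank Φ - 1) < finrank ℚ K)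
    (hA : IsCMTypeRealisation Φ A ι θ) :
    ∃ n m : ℕ, ∃ c : complexBetti (⨁ fun _ : Fin n => A).X (2 * m), IsRationalClass c ∧
      IsOfHodgeType (⨁ fun _ : Fin n => A).dim (⨁ fun _ : Fin n => A).X (2 * m) m m c ∧
      c ∉ divisorClassesSpan (⨁ fun _ : Fin n => A).X (⨁ fun _ : Fin n => A).dim m := by
  obtain ⟨Ψ, hΨ⟩ := exists_eq_inducedCMType_fixedField_twistStabilizer Φ
  haveI : IsCMField (fixedField (twistStabilizer Φ)) :=
    isCMField_of_cmType_intermediateField (fixedField (twistStabilizer Φ)) Ψ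
  have hdeg : ¬ IsNondegenerate Ψ := fun hnd =>
    absurd (eq_of_inducedCMType_isNondegenerate_fixedField hΨ hnd) hlt.ne
  exact exists_exceptional_pow_of_not_isNondegenerate_inducedCMType hΨ
    (pattern_primitive_of_inducedCMType_fixedField_twistStabilizer hΨ) hdeg hA

/-- **THE DICHOTOMY FOR GALOIS CM FIELDS**: for every CM type `Φ` and every abelian variety `A` of type `(K; Φ)`,
EITHER `2·|Stab(Φ)|·(Rank(Φ) − 1) = [K:ℚ]` and `Bᵐ(Aⁿ) ⊗ ℂ = Dᵐ(Aⁿ) ⊗ ℂ` for all `n, m` (so the Hodge conjecture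
holds for all powers, tree `hodgeConjectureFor_pow_of_two_mul_natCard_twistStabilizer_mul_eq`), OR
`2·|Stab(Φ)|·(Rank(Φ) − 1) < [K:ℚ]` and some power of `A` carries an exceptional Hodge class.
[cite: Gordon1999HodgeAVSurvey, Thm. 6.4, §9.2–9.3] [cite: Shimura1998, §8.2 Prop. 26] -/
theorem forall_pow_hodgeClassSpan_eq_or_exists_exceptional [IsGalois ℚ K] (Φ : CMType K)
    (hA : IsCMTypeRealisation Φ A ι θ) :
    (2 * Nat.card (twistStabilizer Φ) * (cmTypeRank Φ - 1) = finrank ℚ K ∧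
        ∀ n m : ℕ, hodgeClassSpan (⨁ fun _ : Fin n => A).dim (⨁ fun _ : Fin n => A).X m =
          divisorClassesSpan (⨁ fun _ : Fin n => A).X (⨁ fun _ : Fin n => A).dim m) ∨
      (2 * Nat.card (twistStabilizer Φ) * (cmTypeRank Φ - 1) < finrank ℚ K ∧
        ∃ n m : ℕ, ∃ c : complexBetti (⨁ fun _ : Fin n => A).X (2 * m), IsRationalClass c ∧
          IsOfHodgeType (⨁ fun _ : Fin n => A).dim (⨁ fun _ : Fin n => A).X (2 * m) m m c ∧
          c ∉ divisorClassesSpan (⨁ fun _ : Fin n => A).X (⨁ fun _ : Fin n => A).dim m) := by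
  rcases (two_mul_natCard_twistStabilizer_mul_cmTypeRank_sub_one_le Φ).eq_or_lt with heq | hlt
  · exact Or.inl ⟨heq, (two_mul_natCard_twistStabilizer_mul_eq_iff_forall_pow_hodgeClassSpan_eq Φ hA).1 heq⟩
  · exact Or.inr ⟨hlt, exists_exceptional_pow_of_two_mul_natCard_twistStabilizer_mul_lt Φ hlt hA⟩

/-- **`K/ℚ` Galois: the Hodge classes of ALL powers are generated by divisors iff those classes are for the
extremal invariant — equivalently iff `Φ` is induced from a NONDEGENERATE type of some CM subfield.**
[cite: Gordon1999HodgeAVSurvey, Thm. 6.4] [cite: Shimura1998, §32.9] -/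
theorem forall_pow_hodgeClassSpan_eq_iff_exists_inducedCMType_isNondegenerate [IsGalois ℚ K] (Φ : CMType K)
    (hA : IsCMTypeRealisation Φ A ι θ) :
    (∀ n m : ℕ, hodgeClassSpan (⨁ fun _ : Fin n => A).dim (⨁ fun _ : Fin n => A).X m =
        divisorClassesSpan (⨁ fun _ : Fin n => A).X (⨁ fun _ : Fin n => A).dim m) ↔
      ∃ (k : IntermediateField ℚ K) (Ψ : CMType k), inducedCMType (algebraMap k K) Ψ = Φ ∧ IsNondegenerate Ψ := by
  rw [← two_mul_natCard_twistStabilizer_mul_eq_iff_forall_pow_hodgeClassSpan_eq Φ hA,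
    two_mul_natCard_twistStabilizer_mul_eq_iff_exists_of_isGalois]

end Hazama

end Literature.AlgebraicGeometry.Pohlmann1968
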